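import Mathlib

/-!
# The four Harder–Narasimhan types of the W4 evaluation cokernel, and the closing arithmetic (Σ(W4))

HONEST FRAMING. Lean index of the computation cell `pub-hsemireg` (W4 widening, lattice-first seat w4-lat-2,
gen 13; doc of record `widen/W4/lat2/code13/SIGMA-W4-CLOSED-w4lat2g13.md` §1–§3, read by the W4 pen,
`widen/W4/w4lat1g16/l2read/READ-SIGMA-CLOSED-w4lat1g16.md`). Elementary integer / `ZMod 4` arithmetic only: no
abelian surface, no sheaf, no Hodge-theoretic statement is formalised here, and nothing in this file says HC,
HC_CM or HC_AV is proved. No `sorry`, no axiom beyond the standard three, no named fact, no `def`.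

CONTEXT (informal, not formalised). On a very general `(1,3)`-polarised abelian surface `B̄` (`NS = ℤν̄`) the
cokernel `𝒬` of the evaluation map of `E = q_*N⁴` (the W4 cell `(7; 4, 12)`) is locally free of rank `4` with
`c₁ = 16ν̄`, every torsion-free quotient of it has normalised slope `> 4/7` (`E` is `μ`-stable of slope `4/7`),
and — the symmetry lemma of the note — every Harder–Narasimhan piece of `𝒬` is invariant under the translation
group `G = q(K(N⁴))`, which forces its `c₁` to lie in `4ℤ·ν̄` (because `7j` must annihilate `B̂[4] ≅ (ℤ/4)⁴`).
Writing the HN subquotients as `(rank r_i, c₁ = j_i ν̄)` with strictly decreasing slopes `j_i / r_i`, the note's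
LEMMA T says that only four types survive: `T1 = (1,3; 12,4)`, `T2 = (1,3; 8,8)`, `T3 = (2,2; 12,4)`,
`T4 = (1,1,2; 8,4,4)`; LEMMAS A/B then give `A ≥ 75` (T1, T2, T4) or `A + B ≥ 30` (T3) for the two numbers
`A = h⁰(𝒬 ⊗ N̄⁻³ ⊗ P′)`, `B = hom(𝒬, N̄⁴ ⊗ P″)`, which the ball-arithmetic certificates bound by `A ≤ 12`,
`B ≤ 0` — a contradiction, so `𝒬` is `μ`-semistable (Σ(W4)).

WHAT IS PROVED HERE (kernel-checked).
* `four_dvd_of_seven_mul_kills_zmod4`: if `7j` acts as zero on `ZMod 4` then `4 ∣ j` (the arithmetic core of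
  the symmetry lemma S1), and its integer form `four_dvd_of_four_dvd_seven_mul`.
* `hn_types_two`, `hn_types_three`, `hn_types_four`: the enumeration of LEMMA T — with `2`, `3` resp. `4`
  HN pieces, the rank / degree / slope constraints leave exactly `T1, T2, T3` (two pieces), exactly `T4`
  (three pieces), and nothing (four pieces).
* `lemmaB_constants`, `whitney_W4`, `closing_contradiction_T3`, `closing_contradiction_line`: the Riemann–Roch
  constants of LEMMA B and the final arithmetic of COROLLARY C.
* `mukai_vector_Q_isotropic`: `v(𝒬) = (4, 16, 192)` is isotropic for `ν̄² = 6` and has `c₂ = 576`.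
-/

namespace Summit.Ventures.HSemireg.EvaluationCokernelHNTypesW4

/-- Arithmetic core of the symmetry lemma S1: if multiplication by `7 j` kills `ZMod 4`
(i.e. `7 j` annihilates `B̂[4] ≅ (ℤ/4)⁴`), then `4 ∣ j`. -/
theorem four_dvd_of_seven_mul_kills_zmod4 (j : ℤ) (h : ∀ x : ZMod 4, ((7 * j : ℤ) : ZMod 4) * x = 0) :
    (4 : ℤ) ∣ j := by
  have h1 : ((7 * j : ℤ) : ZMod 4) = 0 := by simpa using h 1
  have h2 : (4 : ℤ) ∣ 7 * j := by
    have := (ZMod.intCast_zmod_eq_zero_iff_dvd (7 * j) 4).mp h1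
    exact_mod_cast this
  omega

/-- Integer form of S1's last step: `4 ∣ 7 j → 4 ∣ j`. -/
theorem four_dvd_of_four_dvd_seven_mul (j : ℤ) (h : (4 : ℤ) ∣ 7 * j) : (4 : ℤ) ∣ j := by
  omega

/-- LEMMA T, two HN pieces. Ranks `r₁ + r₂ = 4` (`r_i ≥ 1`, as integers), degrees `j₁ + j₂ = 16` with `4 ∣ j_i`,
strictly decreasing slopes `j₁/r₁ > j₂/r₂`, first slope `> 4`, last slope `< 4` and `> 4/7`:
then the type is `T1 = (1,3;12,4)`, `T2 = (1,3;8,8)` or `T3 = (2,2;12,4)` (in particular `r₂ ≠ 1`). -/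
theorem hn_types_two (r₁ r₂ j₁ j₂ : ℤ) (hr₁ : 1 ≤ r₁) (hr₂ : 1 ≤ r₂) (hsum : r₁ + r₂ = 4)
    (hd₁ : (4 : ℤ) ∣ j₁) (hd₂ : (4 : ℤ) ∣ j₂) (hj : j₁ + j₂ = 16)
    (hslope : j₁ * r₂ > j₂ * r₁) (hfirst : j₁ > 4 * r₁)
    (hlast : j₂ < 4 * r₂) (hstab : 7 * j₂ > 4 * r₂) :
    (r₁ = 1 ∧ r₂ = 3 ∧ ((j₁ = 12 ∧ j₂ = 4) ∨ (j₁ = 8 ∧ j₂ = 8))) ∨ (r₁ = 2 ∧ r₂ = 2 ∧ j₁ = 12 ∧ j₂ = 4) := by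
  have hr₁' : r₁ ≤ 3 := by omega
  have hr₂' : r₂ ≤ 3 := by omega
  interval_cases r₁ <;> interval_cases r₂ <;> omega

/-- LEMMA T, three HN pieces: ranks `r₁ + r₂ + r₃ = 4`, degrees summing to `16` in `4ℤ`, strictly decreasing
slopes, first slope `> 4`, last slope in `(4/7, 4)`: then the type is `T4 = (1,1,2; 8,4,4)`. -/
theorem hn_types_three (r₁ r₂ r₃ j₁ j₂ j₃ : ℤ) (hr₁ : 1 ≤ r₁) (hr₂ : 1 ≤ r₂) (hr₃ : 1 ≤ r₃)
    (hsum : r₁ + r₂ + r₃ = 4) (hd₁ : (4 : ℤ) ∣ j₁) (hd₂ : (4 : ℤ) ∣ j₂) (hd₃ : (4 : ℤ) ∣ j₃)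
    (hj : j₁ + j₂ + j₃ = 16) (hs₁₂ : j₁ * r₂ > j₂ * r₁) (hs₂₃ : j₂ * r₃ > j₃ * r₂)
    (hfirst : j₁ > 4 * r₁) (hlast : j₃ < 4 * r₃) (hstab : 7 * j₃ > 4 * r₃) :
    r₁ = 1 ∧ r₂ = 1 ∧ r₃ = 2 ∧ j₁ = 8 ∧ j₂ = 4 ∧ j₃ = 4 := by
  have hr₁' : r₁ ≤ 2 := by omega
  have hr₂' : r₂ ≤ 2 := by omega
  have hr₃' : r₃ ≤ 2 := by omega
  interval_cases r₁ <;> interval_cases r₂ <;> interval_cases r₃ <;> omega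

/-- LEMMA T, four HN pieces (all of rank `1`, degrees `j₁ > j₂ > j₃ > j₄` summing to `16`): impossible —
the last piece would need `j₄ ∈ 4ℤ` with `4/7 < j₄ < 4`. -/
theorem hn_types_four (j₁ j₂ j₃ j₄ : ℤ) (_hj : j₁ + j₂ + j₃ + j₄ = 16) (_hs₁₂ : j₁ > j₂) (_hs₂₃ : j₂ > j₃)
    (_hs₃₄ : j₃ > j₄) (hd₄ : (4 : ℤ) ∣ j₄) (hlast : j₄ < 4) (hstab : 7 * j₄ > 4) : False := by
  omega

/-- The rank-1 last-quotient obstruction on its own: there is no `j ∈ 4ℤ` with `4/7 < j/1 < 4`. -/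
theorem no_rank_one_last_quotient (j : ℤ) (hd : (4 : ℤ) ∣ j) (hlt : j < 4) (hgt : 7 * j > 4) : False := by
  omega

/-- Whitney for `0 → F₁ → 𝒬 → Q″ → 0` in type T3: `c₂(𝒬) = c₂(F₁) + c₂(Q″) + c₁(F₁)·c₁(Q″)` with
`c₂(𝒬) = 576` and `c₁(F₁)·c₁(Q″) = 12·4·6 = 288` gives `c₂(F₁) + c₂(Q″) = 288`. -/
theorem whitney_W4 (c c'' : ℤ) (h : 576 = c + c'' + 12 * 4 * 6) : c + c'' = 288 := by
  omega

/-- The Riemann–Roch constants of LEMMA B: `χ(F₁ ⊗ N̄⁻³P′) = (144·6/2 − c) − 216 + 54 = 270 − c` and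
`χ(Q″^∨ ⊗ N̄⁴P″) ≥ (16·6/2 − c″) − 96 + 96 = 48 − c″ = c − 240` when `c + c″ = 288`. -/
theorem lemmaB_constants (c c'' : ℤ) (h : c + c'' = 288) :
    (144 * 6 / 2 - c) - 216 + 54 = 270 - c ∧ (16 * 6 / 2 - c'') - 96 + 96 = 48 - c'' ∧ 48 - c'' = c - 240 := by
  omega

/-- COROLLARY C for type T3: `A ≥ 270 − c` and `B ≥ c − 240` are incompatible with `A + B ≤ 29`,
whatever `c = c₂(F₁)` is. -/
theorem closing_contradiction_T3 (A B c : ℤ) (hA : A ≥ 270 - c) (hB : B ≥ c - 240) (hAB : A + B ≤ 29) :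
    False := by
  omega

/-- COROLLARY C for types T1, T2, T4: a line subbundle of class `j₁ ν̄`, `j₁ ≥ 8`, gives
`A ≥ 3·(j₁ − 3)² ≥ 75`, incompatible with `A ≤ 74`. -/
theorem closing_contradiction_line (A j₁ : ℤ) (hj : j₁ ≥ 8) (hA : A ≥ 3 * (j₁ - 3) ^ 2) (hA' : A ≤ 74) :
    False := by
  nlinarith

/-- `v(𝒬) = (4, 16ν̄, 192)` is isotropic for the Mukai pairing with `ν̄² = 6` (`6·16² = 2·4·192`),
has `c₂ = c₁²/2 − χ = 576`, and normalised slope `16/4 = 4`; the certified values `A = 12`, `B = 0`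
satisfy the closing criterion `A ≤ 74 ∧ A + B ≤ 29`. -/
theorem mukai_vector_Q_isotropic :
    (6 : ℤ) * 16 ^ 2 = 2 * 4 * 192 ∧ (16 : ℤ) ^ 2 * 6 / 2 - 192 = 576 ∧ (16 : ℤ) / 4 = 4 ∧
    ((12 : ℤ) ≤ 74 ∧ (12 : ℤ) + 0 ≤ 29) := by
  norm_num

end Summit.Ventures.HSemireg.EvaluationCokernelHNTypesW4
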